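import Summits.AtomisticToContinuum.FouriersLaw.Theses.StaticAbelianSqueeze
import Summits.AtomisticToContinuum.FouriersLaw.Theorems.LatticeLandauDampingAbelThermodynamicLimitFixedFrequencyMatchingPairSums
import Summits.AtomisticToContinuum.FouriersLaw.Theorems.EmbeddedDrudeMourreAbelThermodynamicLimitWitnessPositiveType
import HarnessLib

/-!
# Fixed-horizon bulk–boundary decomposition of `c_N` with BOUNDED remainder — what it takes
(stub-worker deliverable for `stub_contactSplice` = (M1) of line `Sketch`, crux stmt-AtomisticToContinuum-13416; scratch
next to the registered stub: it does NOT prove (M1) and is not for landing under the stub's name; sorry-free)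

Notation. `c_N(t) = ∫ J·(P_t J) dμ_{N,T} = Σ_i A^N_i(t)` with the ANCHORED SUMS (rows)
`A^N_i(t) = Σ_k ⟨j_i(0) j_k(t)⟩_{N,T}` of the equilibrium pair correlations of the OPEN `N`-chain (landed
`totalCurrentAutocorr_eq_sum_sum_pairCorr`; the phantom row `i = N-1` is `0`, `bondCurrent_eq_zero_of_last`);
`C_T = D.currentCorrelation μT` the bulk summed correlation of a regular pair `(μT, D)`; depth of the genuine bond
`i ≤ N-2` = `min(i, N-2-i)`.

## Verdict on the lead's sub-question (FIXED horizon, `O(1)` remainder)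

QUESTION: can the tree prove `∀ τ > 0 ∃ K(τ) ∀ N ≫ 1: sup_{t ≤ τ} |c_N(t) − (N−1)C_T(t)| ≤ K(τ)` (or the `L¹((0,τ])` form
with an `N`-free `E_τ`)?  ANSWER: NOT from landed facts; YES from exactly ONE missing lemma `(L_fix)` — §3,
`fixedHorizonSplice_of_depthSummableMatching` (pointwise AND `L¹` form, `E_τ := 0`, `K(τ) = 2Σθ`):

  (L_fix)  ∀ τ > 0 ∃ θ ≥ 0 SUMMABLE, N₀ : ∀ N ≥ N₀, ∀ i with i+1 < N, ∀ t ∈ [0,τ] :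
           |A^N_i(t) − C_T(t)| ≤ θ(min(i, N−2−i))                       (DEPTH-SUMMABLE ANCHORED MATCHING).

Why a RATE is unavoidable. An `N`-uniform `O(1)` remainder says `c_N/N → C_T` at rate `O(1/N)`; any family of engines that
only gives `A^N_i(t) → C_T(t)` as depth `→ ∞` (rate-free) yields `o(N)` and nothing better, and a depth rate `θ` sums to an
`O(1)` remainder iff `Σ_d θ(d) < ∞` (§1–§2). The landed fixed-time engines are rate-free or have NON-summable rates:
 * STATIC (E1) `stub_bulkWindowEquivalence` ← `OscillatorChain.chainSpecification_Icc_tendsto_uniformly`: `ε–N₀`, no rate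
   (the Jentzsch gap `θⁿ` of `PositivityImprovingSpectralGap` is not threaded to window laws; boundary tails only `C/R²`);
 * DYNAMIC (M1sev) `stub_openChainSeveredLocality`: exported `ε–M₀`; internally cone term `O((3+M)⁵4^{−M})` + a bad-event
   term polynomial in the scale (`ρ^{−32}` under two square roots) — a summable rate in `M` is plausible but not extracted;
   `stub_centralWindowDynamicalMatching`: bad event `O(1/R)`, not summable;
 * TAILS (C′) `single_flip_lightCone_summable` / `uniformAnchoredCorrelationTails` (p119825): `a(D) = O(D²2^{−D} + D^{−7/4})`,
   so the `N`-uniform pair-correlation majorant is `ψ(n) ≍ n^{−7/4}` — summable, but `Σ_{n>R} ψ(n) ≍ R^{−3/4}` is NOT summable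
   in `R`, while `(L_fix)` needs `Σ_R Σ_{n>R} ψ(n) = Σ n ψ(n) < ∞`;
 * the infinite-volume side IS quantitative: `InfiniteChainDynamics.exists_summable_l2_locality` (Literature: BM flow vs
   severed flows in `L²(μT)`, summable rate).
Hence what IS landed at fixed horizon is exactly `c_N(t)/N → C_T(t)` (a.e. `t`; `fixedTimeMatching_of_registeredLeaves` ∘
(B′) `stub_uniformFixedTimeOffsetMatching` ∘ (C′), p127009 family) with the `N`-uniform bound `|c_N| ≤ BN` (p144650), i.e.
an `o(N)` remainder; `(L_fix)` = (E1 with summable depth rate) + (M1sev with summable radius rate) + (C′ with `Σ nψ(n) < ∞`,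
e.g. exponential instead of 16th-moment Chebyshev in the failure term) + `exists_summable_l2_locality`, assembled as in
`stub_uniformFixedTimeOffsetMatchingOfEngines` with window radius `≍ depth/2`. Each upgrade is classical (1D transfer-operator
gap; Dobrushin–Fritz iteration with exponential moments), none is landed. CONSEQUENTLY THE GAP IN (M1) IS NOT ONLY THE
PASSAGE FROM FIXED TO LINEAR HORIZON: already the fixed-horizon `O(1)` remainder needs these three rate upgrades.

## The linear-horizon blockers of (M1) itself (§4: type-checked signatures; all open-problem class)

(M1) ⟸ (K3a) ∧ (K3b) ∧ (K2′) + landed facts — FORMALISED, sorry-free, in the scratch file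
`work/stubs/contactSpliceOfLinearCones.lean` (`contactSplice_of_linearCones`, conclusion = the registered signature verbatim;
landable as two `--supports` files, part 1 dry-run ACCEPT): by (K3a) the one-bath layers
`A^L_i = lim_M A^M_i`, `A^R_d = lim_M A^M_{M−2−d}` exist with `|A^N_i − A^L_i| ≤ A e^{(vt − (N−2−i))/ℓ}`; by (K3b) in the limit
`|A^L_i − C_T| ≤ A e^{(vt − i)/ℓ}` (same for `A^R`), so `E(t) := Σ_i (A^L_i(t) − C_T(t)) + Σ_d (A^R_d(t) − C_T(t))` converges,
is measurable (pointwise limits of `pinnedChain_measurable_totalCurrentAutocorr − (N−1)C_T`), locally bounded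
(`|E| ≤ 4Aℓ′e^{vτ/ℓ}` on `[0,τ]`, `ℓ′ = (1 − e^{−1/ℓ})⁻¹`), and splitting the bonds at `N/2`,
`|c_N(t) − (N−1)C_T(t) − E(t)| ≤ 4Aℓ′e^{2/ℓ}·e^{(vt − N/2)/ℓ}` for all `t ≥ 0`; on `(0, c₀N]`, `c₀ := 1/(4v)`, this is
`≤ 4Aℓ′e^{2/ℓ} e^{−N/(4ℓ)}`, so the `L¹` error is `≤ Aℓ′e^{2/ℓ} N e^{−N/(4ℓ)}/v ≤ 4Aℓ′ℓe^{2/ℓ}/(ev) =: K`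
(`setIntegral_abs_le_of_forall_abs_le`); Cesàro-smallness of `E` is (K2′) + dominated convergence at fixed `τ`.
 (K3a) TWO-LENGTH LINEAR LIGHT CONE for anchored sums (both frames): no tree engine reaches `t ≍ N` (landed cones:
       `pinnedChain_singleFlipLocality`, onset `D₀(τ) ≍ τ²`, tails `b(τ)/D²`; fixed-horizon two-length boundary engines in
       stmt-12240's `HalfChainLocality*` helpers; a linear cone is open even pathwise for the infinite quartic-coupling flow,
       Buttà–Marchioro 2016, `InfiniteChainLightCone`); no one-bath chain object is needed in this two-length form;
 (K3b) LINEAR-CONE BULK IDENTIFICATION w.r.t. the regular pair; its fixed-`τ` shadow is `(L_fix)`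
       (`depthSummableMatching_of_linearConeBulk`, §2);
 (K2′) CESÀRO DECAY of the finite-`N` contact layer `c_N − (N−1)C_T` (time decay of current correlations near a bath;
       nearest item `BoundaryEscapeDeficit.HalfChainLocality`, stmt-12240, fixed-`t`, open).
-/

noncomputable section

namespace Summit.AtomisticToContinuum.FouriersLaw.Theorems.UniformAbelianRegularity.ZeroMeanDyadicSplice

open MeasureTheory Set Filter Topology Finset
open Literature.MathematicalPhysics.KineticTheory.HeatConduction OscillatorChain
open Summit.AtomisticToContinuum.FouriersLaw.Theorems.AbelThermodynamicLimit.SeriesLawAtEveryLaplaceFrequency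
  (totalCurrentAutocorr_eq_sum_sum_pairCorr)

/-! ### §1 Bookkeeping -/

/-- **Depth bookkeeping.** For `θ ≥ 0` summable, `Σ_{i < n} θ(min(i, n-1-i)) ≤ 2 Σ θ` (each depth value is taken
at most twice). [folklore] -/
theorem sum_theta_min_depth_le {θ : ℕ → ℝ} (hθ0 : ∀ d, 0 ≤ θ d) (hθ : Summable θ) (n : ℕ) :
    ∑ i : Fin n, θ (min i.val (n - 1 - i.val)) ≤ 2 * ∑' d, θ d := by
  have h1 : ∀ i : Fin n, θ (min i.val (n - 1 - i.val)) ≤ θ i.val + θ (n - 1 - i.val) := by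
    intro i
    rcases min_choice i.val (n - 1 - i.val) with h | h <;> rw [h]
    · exact le_add_of_nonneg_right (hθ0 _)
    · exact le_add_of_nonneg_left (hθ0 _)
  have h2 : ∑ i : Fin n, θ i.val ≤ ∑' d, θ d := by
    rw [Fin.sum_univ_eq_sum_range (fun d => θ d) n]
    exact hθ.sum_le_tsum _ fun d _ => hθ0 d
  have h3 : ∑ i : Fin n, θ (n - 1 - i.val) ≤ ∑' d, θ d := by
    rw [Fin.sum_univ_eq_sum_range (fun d => θ (n - 1 - d)) n, Finset.sum_range_reflect]
    exact hθ.sum_le_tsum _ fun d _ => hθ0 d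
  calc ∑ i : Fin n, θ (min i.val (n - 1 - i.val))
      ≤ ∑ i : Fin n, (θ i.val + θ (n - 1 - i.val)) := Finset.sum_le_sum fun i _ => h1 i
    _ = ∑ i : Fin n, θ i.val + ∑ i : Fin n, θ (n - 1 - i.val) := Finset.sum_add_distrib
    _ ≤ 2 * ∑' d, θ d := by linarith

/-- **`L¹` from `L^∞` on `(0, τ]`**, junk-safe: a pointwise bound `|f| ≤ K` on `[0, τ]` gives `∫_{(0,τ]} |f| ≤ K τ`
(no measurability needed: `norm_setIntegral_le_of_norm_le_const`). [folklore] -/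
theorem setIntegral_abs_le_of_forall_abs_le {f : ℝ → ℝ} {K τ : ℝ} (hτ : 0 ≤ τ)
    (hf : ∀ t ∈ Set.Icc (0 : ℝ) τ, |f t| ≤ K) : ∫ t in Set.Ioc 0 τ, |f t| ≤ K * τ := by
  have h := norm_setIntegral_le_of_norm_le_const (μ := volume) (s := Set.Ioc (0 : ℝ) τ) (f := fun t => |f t|)
    (C := K) (by rw [Real.volume_Ioc]; exact ENNReal.ofReal_lt_top)
    (fun t ht => by simpa using hf t (Set.Ioc_subset_Icc_self ht))
  rw [Real.volume_real_Ioc_of_le hτ, sub_zero, Real.norm_eq_abs] at h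
  exact (le_abs_self _).trans h

/-- **The linear cone at fixed horizon is a summable depth profile**: for `v, ℓ > 0`, `A ≥ 0`, `t ∈ [0, τ]`,
`A e^{-(d - vt)/ℓ} ≤ θ_τ(d) := A e^{vτ/ℓ} (e^{-1/ℓ})^d`, and `θ_τ ≥ 0` is summable (geometric). [folklore] -/
theorem linearCone_le_geometric {v ℓ A τ t : ℝ} (hv : 0 < v) (hℓ : 0 < ℓ) (hA : 0 ≤ A)
    (ht : t ∈ Set.Icc (0 : ℝ) τ) (d : ℕ) :
    A * Real.exp (-((d : ℝ) - v * t) / ℓ) ≤ A * Real.exp (v * τ / ℓ) * Real.exp (-1 / ℓ) ^ d := by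
  rw [mul_assoc]
  refine mul_le_mul_of_nonneg_left ?_ hA
  rw [← Real.exp_nat_mul, ← Real.exp_add]
  refine Real.exp_le_exp.2 ?_
  rw [show -((d : ℝ) - v * t) / ℓ = v * t / ℓ + (d : ℝ) * (-1 / ℓ) by ring]
  have h1 : v * t / ℓ ≤ v * τ / ℓ := div_le_div_of_nonneg_right (by nlinarith [ht.2]) hℓ.le
  linarith

/-- Summability and sign of the geometric depth profile `θ_τ(d) = A e^{vτ/ℓ} (e^{-1/ℓ})^d`. [folklore] -/
theorem geometric_depthProfile_summable {v ℓ A τ : ℝ} (hℓ : 0 < ℓ) (hA : 0 ≤ A) :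
    (∀ d : ℕ, 0 ≤ A * Real.exp (v * τ / ℓ) * Real.exp (-1 / ℓ) ^ d) ∧
      Summable fun d : ℕ => A * Real.exp (v * τ / ℓ) * Real.exp (-1 / ℓ) ^ d := by
  have hr0 : 0 ≤ Real.exp (-1 / ℓ) := (Real.exp_pos _).le
  have hr1 : Real.exp (-1 / ℓ) < 1 := Real.exp_lt_one_iff.2 (by rw [neg_div]; exact neg_neg_of_pos (by positivity))
  exact ⟨fun d => by positivity, (summable_geometric_of_lt_one hr0 hr1).mul_left _⟩

/-! ### §2 The fixed-horizon decomposition from depth-summable matching of the anchored sums -/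

section FixedHorizon

variable {ω₂ lam β γ : ℝ} (hω : 0 < ω₂) (hl : 0 < lam) (hβ : 0 < β) (hγ : 0 < γ) {T : ℝ} (hT : 0 < T)
include hω hl hβ hγ hT

/-- **Pointwise fixed-horizon bulk–boundary decomposition with bounded remainder, from depth-summable matching.**
If on `[0, τ]` the anchored sums `A^N_i(t) = Σ_k ⟨j_i(0) j_k(t)⟩_{N,T}` of the genuine bonds `i ≤ N - 2` of the open
`N`-chain (`N ≥ N₀`) are within `θ(depth of i)` of a bulk function `C(t)`, `depth = min(i, N-2-i)`, with `θ ≥ 0`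
SUMMABLE, then `|c_N(t) - (N-1)·C(t)| ≤ 2 Σ θ` for all `N ≥ max N₀ 1`, `t ∈ [0, τ]`
(`c_N = Σ_i A^N_i`, the phantom row `i = N-1` vanishing). [folklore] -/
theorem abs_totalCurrentAutocorr_sub_linear_le_of_depthSummable {C : ℝ → ℝ} {τ : ℝ} {θ : ℕ → ℝ} {N₀ : ℕ}
    (hθ0 : ∀ d, 0 ≤ θ d) (hθ : Summable θ)
    (hL : ∀ N : ℕ, N₀ ≤ N → ∀ i : Fin N, i.val + 1 < N → ∀ t ∈ Set.Icc (0 : ℝ) τ,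
      |(∑ k : Fin N, ∫ z, (pinnedChain ω₂ lam β γ).bondCurrent N i z *
          (∫ y, (pinnedChain ω₂ lam β γ).bondCurrent N k y
            ∂((pinnedChain ω₂ lam β γ).transitionKernel N T T t.toNNReal z))
          ∂((pinnedChain ω₂ lam β γ).gibbsMeasure N T)) - C t| ≤ θ (min i.val (N - 2 - i.val)))
    (N : ℕ) (hN : N₀ ≤ N) (hN1 : 1 ≤ N) (t : ℝ) (ht : t ∈ Set.Icc (0 : ℝ) τ) :
    |(∫ z, (∑ i : Fin N, (pinnedChain ω₂ lam β γ).bondCurrent N i z) *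
          (∫ y, (∑ i : Fin N, (pinnedChain ω₂ lam β γ).bondCurrent N i y)
            ∂((pinnedChain ω₂ lam β γ).transitionKernel N T T t.toNNReal z))
        ∂((pinnedChain ω₂ lam β γ).gibbsMeasure N T)) - ((N : ℝ) - 1) * C t| ≤ 2 * ∑' d, θ d := by
  obtain ⟨n, rfl⟩ : ∃ n, N = n + 1 := ⟨N - 1, by omega⟩
  set P := pinnedChain ω₂ lam β γ with hP
  set row : Fin (n + 1) → ℝ := fun i => ∑ k : Fin (n + 1), ∫ z, P.bondCurrent (n + 1) i z *
      (∫ y, P.bondCurrent (n + 1) k y ∂(P.transitionKernel (n + 1) T T t.toNNReal z))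
      ∂(P.gibbsMeasure (n + 1) T) with hrow
  have hc := totalCurrentAutocorr_eq_sum_sum_pairCorr hω hl hβ hγ (Nat.succ_pos n) hT (γ := γ) t
  have hlast : row (Fin.last n) = 0 := by
    simp only [hrow]
    refine Finset.sum_eq_zero fun k _ => ?_
    have h0 : ∀ z, P.bondCurrent (n + 1) (Fin.last n) z = 0 := fun z =>
      P.bondCurrent_eq_zero_of_last (n + 1) (Fin.last n) (by simp) z
    simp only [h0, zero_mul, integral_zero]
  have hsum : (∫ z, (∑ i : Fin (n + 1), P.bondCurrent (n + 1) i z) *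
          (∫ y, (∑ i : Fin (n + 1), P.bondCurrent (n + 1) i y)
            ∂(P.transitionKernel (n + 1) T T t.toNNReal z)) ∂(P.gibbsMeasure (n + 1) T)) =
        ∑ i : Fin n, row (Fin.castSucc i) := by
    rw [hc]
    change ∑ i : Fin (n + 1), row i = _
    rw [Fin.sum_univ_castSucc, hlast, add_zero]
  have hcast : (((n + 1 : ℕ) : ℝ) - 1) * C t = ∑ _i : Fin n, C t := by
    simp only [Finset.sum_const, Finset.card_univ, Fintype.card_fin, nsmul_eq_mul]; push_cast; ring
  rw [hsum, hcast, ← Finset.sum_sub_distrib]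
  calc |∑ i : Fin n, (row (Fin.castSucc i) - C t)|
      ≤ ∑ i : Fin n, |row (Fin.castSucc i) - C t| := Finset.abs_sum_le_sum_abs _ _
    _ ≤ ∑ i : Fin n, θ (min i.val (n - 1 - i.val)) := Finset.sum_le_sum fun i _ => by
        have h := hL (n + 1) hN (Fin.castSucc i) (by simp) t ht
        have e : min (Fin.castSucc i).val (n + 1 - 2 - (Fin.castSucc i).val) = min i.val (n - 1 - i.val) := by
          simp only [Fin.val_castSucc]; omega
        rw [e] at h
        exact h
    _ ≤ 2 * ∑' d, θ d := sum_theta_min_depth_le hθ0 hθ n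

omit hω hl hβ hγ hT in
/-- **Depth-summable matching at fixed horizon ⟸ the linear-cone bulk identification (K3b)** (the `τ`-shadow of the
linear-horizon blocker): `|A^N_i(t) - C(t)| ≤ A e^{-(depth - vt)/ℓ}` for all `t ≥ 0` gives, on `[0, τ]`, the
summable geometric profile `θ_τ(d) = A e^{vτ/ℓ}(e^{-1/ℓ})^d`. [folklore] -/
theorem depthSummableMatching_of_linearConeBulk {C : ℝ → ℝ} {v ℓ A : ℝ} {N₀ : ℕ}
    (hv : 0 < v) (hℓ : 0 < ℓ) (hA : 0 ≤ A)
    (hK3b : ∀ N : ℕ, N₀ ≤ N → ∀ i : Fin N, i.val + 1 < N → ∀ t : ℝ, 0 ≤ t →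
      |(∑ k : Fin N, ∫ z, (pinnedChain ω₂ lam β γ).bondCurrent N i z *
          (∫ y, (pinnedChain ω₂ lam β γ).bondCurrent N k y
            ∂((pinnedChain ω₂ lam β γ).transitionKernel N T T t.toNNReal z))
          ∂((pinnedChain ω₂ lam β γ).gibbsMeasure N T)) - C t| ≤
        A * Real.exp (-(((min i.val (N - 2 - i.val) : ℕ) : ℝ) - v * t) / ℓ))
    (τ : ℝ) :
    ∀ N : ℕ, N₀ ≤ N → ∀ i : Fin N, i.val + 1 < N → ∀ t ∈ Set.Icc (0 : ℝ) τ,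
      |(∑ k : Fin N, ∫ z, (pinnedChain ω₂ lam β γ).bondCurrent N i z *
          (∫ y, (pinnedChain ω₂ lam β γ).bondCurrent N k y
            ∂((pinnedChain ω₂ lam β γ).transitionKernel N T T t.toNNReal z))
          ∂((pinnedChain ω₂ lam β γ).gibbsMeasure N T)) - C t| ≤
        A * Real.exp (v * τ / ℓ) * Real.exp (-1 / ℓ) ^ (min i.val (N - 2 - i.val)) :=
  fun N hN i hi t ht => (hK3b N hN i hi t ht.1).trans (linearCone_le_geometric hv hℓ hA ht _)

end FixedHorizon

/-! ### §3 The fixed-horizon splice in the format of (M1), from the ONE missing lemma `(L_fix)` -/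

/-- **(FH) Fixed-horizon contact splice with bounded remainder ⟸ (L_fix) depth-summable anchored matching.**
Hypothesis `(L_fix)` (NOT in the tree; see the module docstring): for every regular pair `(μT, D)` and horizon
`τ > 0` a summable `θ ≥ 0` and `N₀` with `|A^N_i(t) - C_T(t)| ≤ θ(min(i, N-2-i))` for `N ≥ N₀`, genuine bonds `i`,
`t ∈ [0, τ]` (`C_T = D.currentCorrelation μT`). Conclusion: for every `τ > 0` there are `K ≥ 0`, `N₁` with, for
`N ≥ N₁`, the POINTWISE bound `sup_{[0,τ]} |c_N - (N-1)C_T| ≤ K` and the `L¹` bound `∫_{(0,τ]} |c_N - (N-1)C_T| ≤ Kτ`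
(the `L¹` form of (M1) at horizon `τ` with `E_τ := 0`: at fixed horizon every locally bounded contact layer is part of
the `O(1)`). [folklore] -/
theorem fixedHorizonSplice_of_depthSummableMatching
    (hLfix : ∀ ω₂ lam β γ : ℝ, 0 < ω₂ → 0 < lam → 0 < β → 0 < γ → ∀ T : ℝ, 0 < T →
      ∀ (μT : Measure ChainConfig) (D : InfiniteChainDynamics (pinnedChain ω₂ lam β γ)),
        (pinnedChain ω₂ lam β γ).IsChainGibbsMeasure T μT → IsShiftInvariant μT →
        (pinnedChain ω₂ lam β γ).HasSuperstabilityEstimate μT →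
        D.carrier ⊆ (pinnedChain ω₂ lam β γ).bmGood → D.PreservesMeasure μT →
        (∀ t : ℝ, D.HasAbsConvergentCorrelation μT t) →
        ∀ τ : ℝ, 0 < τ → ∃ (θ : ℕ → ℝ) (N₀ : ℕ), (∀ d, 0 ≤ θ d) ∧ Summable θ ∧
          ∀ N : ℕ, N₀ ≤ N → ∀ i : Fin N, i.val + 1 < N → ∀ t ∈ Set.Icc (0 : ℝ) τ,
            |(∑ k : Fin N, ∫ z, (pinnedChain ω₂ lam β γ).bondCurrent N i z *
                (∫ y, (pinnedChain ω₂ lam β γ).bondCurrent N k y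
                  ∂((pinnedChain ω₂ lam β γ).transitionKernel N T T t.toNNReal z))
                ∂((pinnedChain ω₂ lam β γ).gibbsMeasure N T)) - D.currentCorrelation μT t| ≤
              θ (min i.val (N - 2 - i.val))) :
    ∀ ω₂ lam β γ : ℝ, 0 < ω₂ → 0 < lam → 0 < β → 0 < γ → ∀ T : ℝ, 0 < T →
      ∀ (μT : Measure ChainConfig) (D : InfiniteChainDynamics (pinnedChain ω₂ lam β γ)),
        (pinnedChain ω₂ lam β γ).IsChainGibbsMeasure T μT → IsShiftInvariant μT →
        (pinnedChain ω₂ lam β γ).HasSuperstabilityEstimate μT →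
        D.carrier ⊆ (pinnedChain ω₂ lam β γ).bmGood → D.PreservesMeasure μT →
        (∀ t : ℝ, D.HasAbsConvergentCorrelation μT t) →
        ∀ τ : ℝ, 0 < τ → ∃ (K : ℝ) (N₁ : ℕ), 0 ≤ K ∧ ∀ N : ℕ, N₁ ≤ N →
          let J : PhaseSpace N → ℝ := fun z => ∑ i : Fin N, (pinnedChain ω₂ lam β γ).bondCurrent N i z
          (∀ t ∈ Set.Icc (0 : ℝ) τ,
            |(∫ z, J z * (∫ y, J y ∂((pinnedChain ω₂ lam β γ).transitionKernel N T T t.toNNReal z))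
                ∂((pinnedChain ω₂ lam β γ).gibbsMeasure N T)) - ((N : ℝ) - 1) * D.currentCorrelation μT t| ≤ K) ∧
          ∫ t in Set.Ioc 0 τ,
            |(∫ z, J z * (∫ y, J y ∂((pinnedChain ω₂ lam β γ).transitionKernel N T T t.toNNReal z))
                ∂((pinnedChain ω₂ lam β γ).gibbsMeasure N T)) - ((N : ℝ) - 1) * D.currentCorrelation μT t| ≤
            K * τ := by
  intro ω₂ lam β γ hω hl hβ hγ T hT μT D hG hS hss hcar hP hAC τ hτ
  obtain ⟨θ, N₀, hθ0, hθ, hL⟩ := hLfix ω₂ lam β γ hω hl hβ hγ T hT μT D hG hS hss hcar hP hAC τ hτ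
  have hK0 : 0 ≤ 2 * ∑' d, θ d := mul_nonneg zero_le_two (tsum_nonneg hθ0)
  refine ⟨2 * ∑' d, θ d, max N₀ 1, hK0, fun N hN => ?_⟩
  have hpt : ∀ t ∈ Set.Icc (0 : ℝ) τ,
      |(∫ z, (∑ i : Fin N, (pinnedChain ω₂ lam β γ).bondCurrent N i z) *
            (∫ y, (∑ i : Fin N, (pinnedChain ω₂ lam β γ).bondCurrent N i y)
              ∂((pinnedChain ω₂ lam β γ).transitionKernel N T T t.toNNReal z))
          ∂((pinnedChain ω₂ lam β γ).gibbsMeasure N T)) - ((N : ℝ) - 1) * D.currentCorrelation μT t| ≤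
        2 * ∑' d, θ d := fun t ht =>
    abs_totalCurrentAutocorr_sub_linear_le_of_depthSummable hω hl hβ hγ hT hθ0 hθ hL N
      (le_of_max_le_left hN) (le_of_max_le_right hN) t ht
  exact ⟨hpt, setIntegral_abs_le_of_forall_abs_le hτ.le hpt⟩

/-! ### §4 The linear-horizon blockers of (M1), as type-checked signatures

`(L_fix)` is the hypothesis of `fixedHorizonSplice_of_depthSummableMatching` (§3); the per-point `(K3b)` is the hypothesis of
`depthSummableMatching_of_linearConeBulk` (§2). The two blockers from which (M1) FOLLOWS (glue `contactSplice_of_linearCones`,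
scratch file `work/stubs/contactSpliceOfLinearCones.lean`, sorry-free; its two hypotheses are EXACTLY the two `Prop`s below,
and its conclusion is the registered signature of `stub_contactSplice` verbatim): -/

/- **(K3) LINEAR CONES for the anchored sums w.r.t. a regular pair** = (K3a) two-length linear light cone, both frames
(a contact layer stabilises as the far bath recedes, exponentially beyond the cone `N − 2 − i ≥ vt`) ∧ (K3b) linear-cone bulk
identification. No tree engine reaches `t ≍ N`: nearest landed are FIXED-horizon two-length engines of stmt-12240's helpers
(`HalfChainLocality.exists_windowDensity_bound_and_limit`: boundary-window Gibbs densities across lengths, uniform bound `D*`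
and `ε–N₀` convergence, geometric rate internal; `…HalfChainLocalityPropagation`: common-noise two-length pathwise locality at
the left boundary) and the fixed-horizon cones `pinnedChain_singleFlipLocality` (onset `D₀(τ) ≍ τ²`); a linear cone is open
even pathwise for the infinite quartic-coupling flow (Buttà–Marchioro 2016, `InfiniteChainLightCone`). -/
example : Prop :=
  ∀ ω₂ lam β γ : ℝ, 0 < ω₂ → 0 < lam → 0 < β → 0 < γ → ∀ T : ℝ, 0 < T →
      ∀ (μT : Measure ChainConfig) (D : InfiniteChainDynamics (pinnedChain ω₂ lam β γ)),
        (pinnedChain ω₂ lam β γ).IsChainGibbsMeasure T μT → IsShiftInvariant μT →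
        (pinnedChain ω₂ lam β γ).HasSuperstabilityEstimate μT →
        D.carrier ⊆ (pinnedChain ω₂ lam β γ).bmGood → D.PreservesMeasure μT →
        (∀ t : ℝ, D.HasAbsConvergentCorrelation μT t) →
        ∃ (v ℓ A : ℝ) (N₀ : ℕ), 0 < v ∧ 0 < ℓ ∧ 0 ≤ A ∧
          (∀ (N M : ℕ) (hN : N₀ ≤ N) (hNM : N ≤ M) (i : ℕ) (hi : i + 2 ≤ N) (t : ℝ), 0 ≤ t →
            |(∑ k : Fin N, ∫ z, (pinnedChain ω₂ lam β γ).bondCurrent N ⟨i, by omega⟩ z *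
                  (∫ y, (pinnedChain ω₂ lam β γ).bondCurrent N k y
                    ∂((pinnedChain ω₂ lam β γ).transitionKernel N T T t.toNNReal z))
                  ∂((pinnedChain ω₂ lam β γ).gibbsMeasure N T)) -
                ∑ k : Fin M, ∫ z, (pinnedChain ω₂ lam β γ).bondCurrent M ⟨i, by omega⟩ z *
                  (∫ y, (pinnedChain ω₂ lam β γ).bondCurrent M k y
                    ∂((pinnedChain ω₂ lam β γ).transitionKernel M T T t.toNNReal z))
                  ∂((pinnedChain ω₂ lam β γ).gibbsMeasure M T)| ≤
              A * Real.exp (-(((N - 2 - i : ℕ) : ℝ) - v * t) / ℓ) ∧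
            |(∑ k : Fin N, ∫ z, (pinnedChain ω₂ lam β γ).bondCurrent N ⟨N - 2 - i, by omega⟩ z *
                  (∫ y, (pinnedChain ω₂ lam β γ).bondCurrent N k y
                    ∂((pinnedChain ω₂ lam β γ).transitionKernel N T T t.toNNReal z))
                  ∂((pinnedChain ω₂ lam β γ).gibbsMeasure N T)) -
                ∑ k : Fin M, ∫ z, (pinnedChain ω₂ lam β γ).bondCurrent M ⟨M - 2 - i, by omega⟩ z *
                  (∫ y, (pinnedChain ω₂ lam β γ).bondCurrent M k y
                    ∂((pinnedChain ω₂ lam β γ).transitionKernel M T T t.toNNReal z))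
                  ∂((pinnedChain ω₂ lam β γ).gibbsMeasure M T)| ≤
              A * Real.exp (-(((N - 2 - i : ℕ) : ℝ) - v * t) / ℓ)) ∧
          (∀ (N : ℕ) (hN : N₀ ≤ N) (i : ℕ) (hi : i + 2 ≤ N) (t : ℝ), 0 ≤ t →
            |(∑ k : Fin N, ∫ z, (pinnedChain ω₂ lam β γ).bondCurrent N ⟨i, by omega⟩ z *
                  (∫ y, (pinnedChain ω₂ lam β γ).bondCurrent N k y
                    ∂((pinnedChain ω₂ lam β γ).transitionKernel N T T t.toNNReal z))
                  ∂((pinnedChain ω₂ lam β γ).gibbsMeasure N T)) - D.currentCorrelation μT t| ≤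
              A * Real.exp (-(((min i (N - 2 - i) : ℕ) : ℝ) - v * t) / ℓ))

/- **(K2′) CESÀRO DECAY OF THE CONTACT LAYER, finite-`N` form** (gives the Cesàro clause of (M1) for the limit layer by
dominated convergence at fixed `τ`): time decay of current correlations near a bath; no tree item (nearest:
`BoundaryEscapeDeficit.HalfChainLocality`, stmt-12240, fixed-`t`, open). -/
example : Prop :=
  ∀ ω₂ lam β γ : ℝ, 0 < ω₂ → 0 < lam → 0 < β → 0 < γ → ∀ T : ℝ, 0 < T →
      ∀ (μT : Measure ChainConfig) (D : InfiniteChainDynamics (pinnedChain ω₂ lam β γ)),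
        (pinnedChain ω₂ lam β γ).IsChainGibbsMeasure T μT → IsShiftInvariant μT →
        (pinnedChain ω₂ lam β γ).HasSuperstabilityEstimate μT →
        D.carrier ⊆ (pinnedChain ω₂ lam β γ).bmGood → D.PreservesMeasure μT →
        (∀ t : ℝ, D.HasAbsConvergentCorrelation μT t) →
        ∀ ε : ℝ, 0 < ε → ∃ τ₀ : ℝ, 0 < τ₀ ∧ ∀ τ : ℝ, τ₀ ≤ τ → ∃ N₁ : ℕ, ∀ N : ℕ, N₁ ≤ N →
          let J : PhaseSpace N → ℝ := fun z => ∑ i : Fin N, (pinnedChain ω₂ lam β γ).bondCurrent N i z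
          ∫ t in Set.Ioc 0 τ, |(∫ z, J z * (∫ y, J y ∂((pinnedChain ω₂ lam β γ).transitionKernel N T T t.toNNReal z))
              ∂((pinnedChain ω₂ lam β γ).gibbsMeasure N T)) - ((N : ℝ) - 1) * D.currentCorrelation μT t| ≤ ε * τ

end Summit.AtomisticToContinuum.FouriersLaw.Theorems.UniformAbelianRegularity.ZeroMeanDyadicSplice

end
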